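/-
Copyright (c) 2026 the pub-hodgecm-mathlib formalisation cell (harness21).  Prover seat hodgecm-mathlib-K2E1-p14 (g0), Track B «K2-LIT» ENGINE E1, h413 =
`stmt-HodgeConjecture-24833`, route `HCCMUnconditional`, campaign «5Res» (b) — the GENERIC-EIGENVALUE EDITION of X1_χ §1, ruling K2E1-plan (g7) (170) on the currency finding R4.
-/
import Summits.HodgeConjecture.HodgeConjecture.Theorems.K2E1ChiEisensteinMeromorphicExportsU2   -- ★ X1_χ §1 + ED. 2 (this seat): the ĥ-currency theorem this file generalises, and its imports
import HarnessLib

/-!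
# h413 ∕ Track B «K2-LIT», 5Res (b) — `K2E1ChiEisensteinMeromorphicExportsU2Eigen`: THE BY-PRODUCTS OF THE (χ,τ) BERNSTEIN–LAPID SYSTEM ON A BALL IN THE GENERIC-EIGENVALUE CURRENCY
# (`ŝ_i(z)` entire, in place of the spherical transforms `ĥ_i(z) = ∫ h_i·H^z dν_G`)

Cell `pub/hodgecm-mathlib`, crux H413 = `stmt-HodgeConjecture-24833`; ruling K2E1-plan (g7) (170) (the currency finding of this seat's R4, 2026-09-04T11:50Z): for a (χ,τ)-section
space with `χ_∞ ≠ 1` or a non-trivial `K_∞`-type the arch-only test functions act on `V ⊗ H^z` by the `(χ_∞,ω)`-SPHERICAL TRANSFORM `ŝ(z)`, NOT by `ĥ(z) = ∫ h·H^z dν_G`; the 12-block's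
letters must therefore carry ABSTRACT eigenvalue functions.  THEOREMS ONLY (no `def`, no `instance`, no `notation`, no named-fact hypothesis, no `sorry`); lane `--kind proof --supports
stmt-HodgeConjecture-24833 --as helper` (count-neutral).

THIS FILE = ★ `exists_chi_xSystem_byproducts'` (X1_χ §1 ED. 2, this seat) VERBATIM with every spherical transform `(∫ x, h i x * ↑↑(borelHeight x) ^ z ∂νG)` replaced by `ŝ i z` for a
family of ENTIRE functions `ŝ : I → ℂ → ℂ` (letter `hŝ : ∀ i, Differentiable ℂ (ŝ i)`, supplied by ★ convData_χ `exists_chi_convData_cm_two`): the holomorphy∕continuity of `ĥ_i`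
(★ `differentiable_integral_mul_borelHeight_cpow`) is the ONLY property of the transforms the ★ proof used.  Everything else (★ 11b `exists_xSystem_finDim` — generic in the
eigenvalue functions —, ★ Thm 2.3 `exists_solution_byproducts`, the scalarisation and normal-form gluing) is unchanged.  Consumers: the generic-(ŝ editions of) 12b ∕ hunq_χ ∕ X2_χ core
(owners per (170)) and the general (χ,τ) CM assembly over ★ convData_χ.
HONEST LABEL: HC_CM is proved only modulo the 7 printed citations (2 remaining named inputs: hLiu418 = `stmt-HodgeConjecture-24832`, h413 = `stmt-HodgeConjecture-24833`) until rung 0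
closes; count-neutral helper, closes no socket.

## References
* [BernsteinLapid2019] J. Bernstein, E. Lapid, *On the meromorphic continuation of Eisenstein series*, J. Amer. Math. Soc. 37 (2024) (arXiv:1911.02342), Thm 2.3, Cor. 2.5, §4.
* [MoeglinWaldspurger1995] C. Mœglin, J.-L. Waldspurger, *Spectral Decomposition and Eisenstein Series* (1995), IV.1.8–IV.1.9.
-/

set_option autoImplicit false
-- the mandated namespace repeats `HodgeConjecture.HodgeConjecture`, as in every `Theorems/*.lean` of this sub-problem
set_option linter.dupNamespace false

noncomputable section

open MeasureTheory Filter Topology Set Submodule NumberField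
open scoped NNReal ENNReal Classical
open Literature.NumberTheory.Automorphic Literature.NumberTheory.Automorphic.UnitaryGroup AdelicGroupData
open Summit.HodgeConjecture.HodgeConjecture.Cruxes.H413.K2E1BorelEisensteinU
open Summit.HodgeConjecture.HodgeConjecture.Cruxes.H413.K2E1BLBorelSpacesU2Defs
open Summit.HodgeConjecture.HodgeConjecture.Cruxes.H413.K2E1BLBorelOperatorsU2Defs
open Summit.HodgeConjecture.HodgeConjecture.Cruxes.H413.K2E1BLMeromorphicGluing (meromorphicOn_scalarisation toMeromorphicNFOn_eqOn_of_eventuallyEq)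
open Summit.HodgeConjecture.HodgeConjecture.Cruxes.H413.K2E1MeromorphicSolutionPrincipleLocal (eventually_ne_zero_of_analyticOnNhd exists_mem_ne_zero_of_isOpen)
open Summit.HodgeConjecture.HodgeConjecture.Cruxes.H413.K2E1BLXSystemPackageFinDimU (exists_xSystem_finDim xSystem_existsUnique_of_finDim)
open Summit.HodgeConjecture.HodgeConjecture.Cruxes.H413.K2E1SphericalEisensteinMeromorphicBallU2 (piN_comp_restrHN_comp_iota isCompactOperator_deltaShift_comp_one_sub_cnstN)
open Summit.HodgeConjecture.HodgeConjecture.Cruxes.H413.K2E1BLMeromorphicFamilyByproductsU (exists_solution_byproducts)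

open Summit.HodgeConjecture.HodgeConjecture.Cruxes.H413.K2E1ChiEisensteinMeromorphicExportsU2

namespace Summit.HodgeConjecture.HodgeConjecture.Cruxes.H413.K2E1ChiEisensteinMeromorphicExportsU2Eigen

variable {F E : Type} [Field F] [NumberField F] [Field E] [NumberField E] [Algebra F E] {c : E ≃ₐ[F] E} {N : ℕ} [NeZero N]
variable [MeasurableSpace (quasiSplit F E c N).Adelic]

/-- **GENERIC-EIGENVALUE EDITION (`ŝ i z` for `∫ h_i·H^z`).** ED. 2 — THE SAME BY-PRODUCTS WITH THE MEROMORPHY OF THE CONTINUED PARAMETER `cc` ON THE BALL KEPT** (the input of the coefficient gluing of X2_χ: `cc = snd ∘ v` for the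
meromorphic solution `v` of ★ `exists_solution_byproducts`, so `cc` is meromorphic on `ball 0 (n+2)` — the (χ,τ) counterpart of ★ X2a §1 `meromorphicOn_coeff_of_system`, which had to
recover it for the scalar coefficient after the fact).  Statement = §1's with the extra clause `MeromorphicOn cc (ball 0 (n+2))`; same proof.
[cite: BernsteinLapid2019, Thm 2.3, §2.1 and §4 p. 10] [cite: ReedSimonI1980, Thm. VI.14] -/
theorem exists_chi_xSystem_byproducts_of_eigen (σ₀ : ℝ) (n k : ℕ) {μ : Measure (quasiSplit F E c N).automorphicQuotient}
    {μZ : Measure (borelQuotient F E c N)} (νG : Measure (quasiSplit F E c N).Adelic) [IsFiniteMeasureOnCompacts νG]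
    -- levels and the ι-package
    {I : Type} [Fintype I] {a : ℝ≥0} (ha : 0 < a) {a₀ : I → ℝ≥0} (haa₀ : ∀ i, a ≤ a₀ i)
    [hfin₀ : ∀ i, IsFiniteMeasure (weightedTruncMeasure F E c N k (a₀ i) μZ)] (hb : IotaBound F E c N k a μ μZ) (hb₀ : ∀ i, IotaBound F E c N k (a₀ i) μ μZ)
    (hcl₀ : ∀ i, IsClosed ((LinearMap.range (iota (hb₀ i)).toLinearMap : Submodule ℂ (HN F E c N k (a₀ i) μZ)) : Set (HN F E c N k (a₀ i) μZ)))
    (hinj₀ : ∀ i, Function.Injective (iota (hb₀ i)))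
    -- the good test functions and their transforms
    (h : I → (quasiSplit F E c N).Adelic → ℂ)   -- (no continuity ∕ support hypotheses needed in this currency: they served only the holomorphy of `ĥ_i`)
    -- the EIGENVALUE FUNCTIONS (entire; e.g. ★ convData_χ's `ŝ i`): in the (χ,τ) currency they replace the spherical transforms `∫ h_i·H^z`
    (ŝ : I → ℂ → ℂ) (hŝ : ∀ i, Differentiable ℂ (ŝ i))
    (hcov : ∀ z ∈ Metric.ball (0 : ℂ) (n + 2), ∃ i, (ŝ i z) ≠ 0)
    -- the `Z`-side Hecke operators (★ `ShiftBound`) and K2's decay letters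
    (hs : ∀ i, ShiftBound F E c N k a (a₀ i) νG μZ (h i)) {m C : I → ℝ} (hm : ∀ i, 0 ≤ m i) (hC : ∀ i, 0 ≤ C i)
    (hK1 : ∀ i, ∀ f : HNcusp F E c N k a μZ, ∀ᵐ z ∂(weightedTruncMeasure F E c N k (a₀ i) μZ),
      ‖rightConvFun F E c N νG (h i) ((f : HN F E c N k a μZ) : borelQuotient F E c N → ℂ) z‖ ≤ C i * ‖f‖ * ((borelQuotHeight F E c N z : ℝ)) ^ (-m i))
    -- the `𝔛`-side Hecke operators and the intertwining (P3-C)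
    (T : I → HX F E c N k μ →L[ℂ] HX F E c N k μ) (hδι : ∀ i, deltaShift (hs i) ∘L iota hb = restrHN F E c N k (haa₀ i) μZ ∘L iota hb ∘L T i)
    -- the constant-term data: `α₁` (`[f_z^φ]`) and the finite-dimensional family `L` (`b ↦ Σ_j b_j [f^{φ′_j}_{ρ₀−z}]`), holomorphic on the ball, `L z` injective on the Godement part; `Q`
    {α₁ : ℂ → HN F E c N k a μZ} (hα₁d : DifferentiableOn ℂ α₁ (Metric.ball (0 : ℂ) (n + 2)))
    {B : Type*} [NormedAddCommGroup B] [NormedSpace ℂ B] [FiniteDimensional ℂ B] {L : ℂ → B →L[ℂ] HN F E c N k a μZ} (hL : DifferentiableOn ℂ L (Metric.ball (0 : ℂ) (n + 2)))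
    (hLinj : ∀ z ∈ Metric.ball (0 : ℂ) (n + 2), σ₀ < z.re → Function.Injective (L z))
    {X' : Type} [NormedAddCommGroup X'] [NormedSpace ℂ X'] [CompleteSpace X'] (Q : HX F E c N k μ →L[ℂ] X') (φ₀ : ℂ)
    -- the Eisenstein data in `𝓗_k(𝔛) × B` on the Godement part `{σ₀ < Re z}` of the ball
    (eX : ℂ → HX F E c N k μ) (bX : ℂ → B)
    (hsolT : ∀ z ∈ Metric.ball (0 : ℂ) (n + 2), σ₀ < z.re → ∀ i, T i (eX z) = (ŝ i z) • eX z)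
    (hsolC : ∀ z ∈ Metric.ball (0 : ℂ) (n + 2), σ₀ < z.re → cnstN F E c N k a μZ (iota hb (eX z)) = φ₀ • α₁ z + L z (bX z))
    (hsolQ : ∀ z ∈ Metric.ball (0 : ℂ) (n + 2), σ₀ < z.re → Q (eX z) = 0)
    -- uniqueness of the `ψ`-component on an open non-empty part of the Godement set (row 12a∕12c's letter)
    (hunq : ∃ U₀ : Set ℂ, IsOpen U₀ ∧ U₀.Nonempty ∧ U₀ ⊆ Metric.ball (0 : ℂ) (n + 2) ∩ {z : ℂ | σ₀ < z.re} ∧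
      ∀ z ∈ U₀, ∀ (ψ : HX F E c N k μ) (b : B), (∀ i, T i ψ = (ŝ i z) • ψ) →
        cnstN F E c N k a μZ (iota hb ψ) = φ₀ • α₁ z + L z b → Q ψ = 0 → ψ = eX z) :
    ∃ (U : Set ℂ) (vX : ℂ → HX F E c N k μ) (cc : ℂ → B),
      IsOpen U ∧ U ⊆ Metric.ball (0 : ℂ) (n + 2) ∧ Metric.ball (0 : ℂ) (n + 2) ⊆ closure U ∧ (∀ z₀ ∈ Metric.ball (0 : ℂ) (n + 2), ∀ᶠ s in 𝓝[≠] z₀, s ∈ U) ∧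
      DifferentiableOn ℂ vX U ∧ MeromorphicOn vX (Metric.ball (0 : ℂ) (n + 2)) ∧ DifferentiableOn ℂ cc U ∧ MeromorphicOn cc (Metric.ball (0 : ℂ) (n + 2)) ∧
      (∀ z ∈ U, (∀ i, T i (vX z) = (ŝ i z) • vX z) ∧
        cnstN F E c N k a μZ (iota hb (vX z)) = φ₀ • α₁ z + L z (cc z) ∧ Q (vX z) = 0) ∧
      (∀ z ∈ U, ∀ (ψ : HX F E c N k μ) (b : B), (∀ i, T i ψ = (ŝ i z) • ψ) →
        cnstN F E c N k a μZ (iota hb ψ) = φ₀ • α₁ z + L z b → Q ψ = 0 → ψ = vX z ∧ b = cc z) ∧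
      (∀ z ∈ U, σ₀ < z.re → vX z = eX z ∧ cc z = bX z) ∧
      ∀ (Es : ℂ → ℂ) (Λ : I → HX F E c N k μ →L[ℂ] ℂ),
        (∀ i, ∀ z ∈ Metric.ball (0 : ℂ) (n + 2), σ₀ < z.re → Λ i (eX z) = (ŝ i z) * Es z) →
        ∃ Ec : ℂ → ℂ, MeromorphicOn Ec (Metric.ball (0 : ℂ) (n + 2)) ∧ (∀ z ∈ Metric.ball (0 : ℂ) (n + 2), σ₀ < z.re → Ec z = Es z) ∧
          (∀ j, ∀ z ∈ U, (ŝ j z) ≠ 0 →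
            Ec =ᶠ[𝓝[≠] z] fun s => (ŝ j s)⁻¹ * Λ j (vX s)) ∧
          ∀ z ∈ U, 0 ≤ meromorphicOrderAt Ec z := by
  -- abbreviations
  set D : Set ℂ := Metric.ball (0 : ℂ) (n + 2) with hDdef
  set O : Set ℂ := {z : ℂ | σ₀ < z.re} with hOdef
  have hD : IsOpen D := Metric.isOpen_ball
  have hDc : IsPreconnected D := (convex_ball (0 : ℂ) _).isPreconnected
  have hO : IsOpen O := isOpen_lt continuous_const Complex.continuous_re
  -- holomorphy of the transforms (verbatim ★ P8 §2); `α₁`, `L` are holomorphic by hypothesis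
  have hĥd : ∀ i, DifferentiableOn ℂ (ŝ i) D := fun i => (hŝ i).differentiableOn
  have hĥa : ∀ i, AnalyticOnNhd ℂ (ŝ i) D := fun i => (hĥd i).analyticOnNhd hD
  -- the packaged `𝔛`-system with a finite-dimensional parameter (★ row 11b `exists_xSystem_finDim`) — `g`-free
  haveI : CompleteSpace B := FiniteDimensional.complete ℂ B
  haveI : CompleteSpace ((I → HX F E c N k μ) × (HN F E c N k a μZ × X')) := inferInstance
  obtain ⟨A, c𝓦, hA, hc𝓦, hchar, hfinT⟩ := exists_xSystem_finDim (V₀ := fun i => HN F E c N k (a₀ i) μZ) hD T hĥd hcov (iota hb) (cnstN F E c N k a μZ) Q hα₁d hL φ₀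
    (fun i => deltaShift (hs i)) (fun i => restrHN F E c N k (haa₀ i) μZ) (fun i => piN (hb₀ i) (hcl₀ i) (hinj₀ i)) hδι
    (fun i => piN_comp_restrHN_comp_iota (haa₀ i) hb (hb₀ i) (hcl₀ i) (hinj₀ i))
    (fun i => isCompactOperator_deltaShift_comp_one_sub_cnstN (lt_of_lt_of_le ha (haa₀ i)) (hs i) (hm i) (hC i) (hK1 i))
  -- existence on the Godement set, uniqueness on `U₀`
  have hsol : ∀ z ∈ D ∩ O, A z ((fun z => (eX z, bX z)) z) = c𝓦 z := fun z hz =>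
    (hchar z (eX z) (bX z)).2 ⟨hsolT z hz.1 hz.2, hsolC z hz.1 hz.2, hsolQ z hz.1 hz.2⟩
  obtain ⟨U₀, hU₀o, ⟨x₀, hx₀⟩, hU₀D, hU₀unq⟩ := hunq
  have hx : x₀ ∈ D ∩ O := hU₀D hx₀
  have hunq' : ∃ U₀ : Set ℂ, IsOpen U₀ ∧ U₀.Nonempty ∧ U₀ ⊆ D ∩ O ∧ ∀ z ∈ U₀, ∀ w : HX F E c N k μ × B, A z w = c𝓦 z → w = (fun z => (eX z, bX z)) z := by
    refine ⟨U₀, hU₀o, ⟨x₀, hx₀⟩, hU₀D, fun z hz w hw => ?_⟩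
    have hex : ∃! x : HX F E c N k μ × B, A z x = c𝓦 z :=
      xSystem_existsUnique_of_finDim hchar (hLinj z (hU₀D hz).1 (hU₀D hz).2) (hsol z (hU₀D hz)) fun ψ b hψb =>
        hU₀unq z hz ψ b ((hchar z ψ b).1 hψb).1 ((hchar z ψ b).1 hψb).2.1 ((hchar z ψ b).1 hψb).2.2
    exact hex.unique hw (hsol z (hU₀D hz))
  -- Thm 2.3 with the holomorphy set kept
  obtain ⟨v, U, hUo, hUD, hcl, hUcd, hvU, hvmer, hsolU, hve⟩ := exists_solution_byproducts hD hDc hA hc𝓦 hfinT hsol hunq'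
  -- the components
  have hfst : ∀ z, (v z).1 = (ContinuousLinearMap.fst ℂ (HX F E c N k μ) B) (v z) := fun z => rfl
  have hsnd : ∀ z, (v z).2 = (ContinuousLinearMap.snd ℂ (HX F E c N k μ) B) (v z) := fun z => rfl
  have hvXd : DifferentiableOn ℂ (fun z => (v z).1) U := (ContinuousLinearMap.fst ℂ (HX F E c N k μ) B).differentiable.comp_differentiableOn hvU
  have hccd : DifferentiableOn ℂ (fun z => (v z).2) U := (ContinuousLinearMap.snd ℂ (HX F E c N k μ) B).differentiable.comp_differentiableOn hvU
  have hvXm : MeromorphicOn (fun z => (v z).1) D := fun z hz => (ContinuousLinearMap.fst ℂ (HX F E c N k μ) B).comp_meromorphicAt (hvmer z hz)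
  have hccm : MeromorphicOn (fun z => (v z).2) D := fun z hz => (ContinuousLinearMap.snd ℂ (HX F E c N k μ) B).comp_meromorphicAt (hvmer z hz)
  -- the equations on `U` and uniqueness there
  have hsolv : ∀ z ∈ U, A z (v z) = c𝓦 z := fun z hz => (hsolU z hz (v z)).2 rfl
  have heqs : ∀ z ∈ U, (∀ i, T i (v z).1 = (ŝ i z) • (v z).1) ∧ cnstN F E c N k a μZ (iota hb (v z).1) = φ₀ • α₁ z + L z (v z).2 ∧ Q (v z).1 = 0 :=
    fun z hz => (hchar z (v z).1 (v z).2).1 (hsolv z hz)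
  refine ⟨U, fun z => (v z).1, fun z => (v z).2, hUo, hUD, hcl, hUcd, hvXd, hvXm, hccd, hccm, heqs, fun z hz ψ b h1 h2 h3 => ?_, fun z hz hz1 => ?_, fun Es Λ hΛ => ?_⟩
  · have hw : (ψ, b) = v z := (hsolU z hz (ψ, b)).1 ((hchar z ψ b).2 ⟨h1, h2, h3⟩)
    exact ⟨congrArg Prod.fst hw, congrArg Prod.snd hw⟩
  · have hw : v z = (eX z, bX z) := hve z ⟨hz, hz1⟩
    exact ⟨congrArg Prod.fst hw, congrArg Prod.snd hw⟩
  -- the scalar piece: scalarise through an index `j₀` with `ĥ_{j₀}(0) ≠ 0`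
  have h0D : (0 : ℂ) ∈ D := by rw [hDdef]; exact Metric.mem_ball_self (by positivity)
  obtain ⟨j₀, hj₀⟩ := hcov 0 h0D
  have hĥc : ∀ j, Continuous (ŝ j) := fun j => (hŝ j).continuous
  have hvXU : ∀ s ∈ U, σ₀ < s.re → (v s).1 = eX s := fun s hs hs1 => congrArg Prod.fst (hve s ⟨hs, hs1⟩)
  -- the local analytic germs `g_j := ĥ_j⁻¹ · Λ_j ∘ vX`, analytic on `U ∩ {ĥ_j ≠ 0}`, `= Es` on `U ∩ O` there
  have hgerm : ∀ j, ∀ z ∈ U, (ŝ j z) ≠ 0 → AnalyticAt ℂ (fun s => (ŝ j s)⁻¹ * Λ j (v s).1) z := by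
    intro j z hz hjz
    have hva : AnalyticAt ℂ v z := hvU.analyticAt (hUo.mem_nhds hz)
    have h2 : AnalyticAt ℂ (fun s => Λ j (v s).1) z := ((Λ j ∘L ContinuousLinearMap.fst ℂ (HX F E c N k μ) B).analyticAt (v z)).comp hva
    exact ((hĥa j z (hUD hz)).inv hjz).mul h2
  have hEq : ∀ j, ∀ s ∈ U, s ∈ D → σ₀ < s.re → (ŝ j s) ≠ 0 → (ŝ j s)⁻¹ * Λ j (v s).1 = Es s := by
    intro j s hsU hsD hs1 hjs
    rw [hvXU s hsU hs1, hΛ j s hsD hs1, inv_mul_cancel_left₀ hjs]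
  -- the scalarisations `S j`, meromorphic on `D` as soon as `ĥ_j ≢ 0`
  have hSmer : ∀ j, ∀ z₁ ∈ D, (ŝ j z₁) ≠ 0 → MeromorphicOn (fun z => if z ∈ O then Es z else (ŝ j z)⁻¹ * Λ j (v z).1) D := by
    intro j z₁ hz₁ hjz₁
    refine meromorphicOn_scalarisation hvXm (Λ j) (hĥa j).meromorphicOn Es fun z₀ hz₀ => ?_
    filter_upwards [hUcd z₀ hz₀, eventually_ne_zero_of_analyticOnNhd hDc (hĥa j) hz₁ hjz₁ hz₀, mem_nhdsWithin_of_mem_nhds (hD.mem_nhds hz₀)] with s hsU hĥs hsD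
    intro hsO
    exact ⟨hĥs, by rw [hvXU s hsU hsO, hΛ j s hsD hsO]⟩
  -- near a point of `U` where `ĥ_j ≠ 0`, every `S j'` (with `ĥ_{j'} ≢ 0`) is eventually the germ `g_j`
  have hloc : ∀ j', ∀ z₁' ∈ D, (ŝ j' z₁') ≠ 0 → ∀ j, ∀ z ∈ U, (ŝ j z) ≠ 0 →
      (fun z => if z ∈ O then Es z else (ŝ j' z)⁻¹ * Λ j' (v z).1) =ᶠ[𝓝[≠] z] fun s => (ŝ j s)⁻¹ * Λ j (v s).1 := by
    intro j' z₁' hz₁' hj'z₁' j z hz hjz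
    -- a base point `z₁ ∈ U ∩ (D ∩ O)` with `ĥ_j(z₁) ≠ 0` (`D ∩ O` is non-empty: it contains `U₀ ∋ x₀`)
    have hVo : IsOpen ((D ∩ O) ∩ U) := (hD.inter hO).inter hUo
    have hVne : ((D ∩ O) ∩ U).Nonempty := mem_closure_iff_nhds.1 (hcl hx.1) _ ((hD.inter hO).mem_nhds hx)
    obtain ⟨z₁, hz₁V, hjz₁⟩ := exists_mem_ne_zero_of_isOpen hDc (hĥa j) (hUD hz) hjz hVo (fun s hs => hs.1.1) hVne
    -- both pieces equal `Es` near `z₁`, and the germ `g_j` equals `Es` there too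
    have hWo : IsOpen (((D ∩ O) ∩ U) ∩ {s | (ŝ j s) ≠ 0}) := hVo.inter (isOpen_ne_fun (hĥc j) continuous_const)
    have hW1 : ((D ∩ O) ∩ U) ∩ {s | (ŝ j s) ≠ 0} ∈ 𝓝 z₁ := hWo.mem_nhds ⟨hz₁V, hjz₁⟩
    have hgerm₁ : AnalyticAt ℂ (fun s => (ŝ j s)⁻¹ * Λ j (v s).1) z₁ := hgerm j z₁ hz₁V.2 hjz₁
    have hf : (fun z => if z ∈ O then Es z else (ŝ j' z)⁻¹ * Λ j' (v z).1) =ᶠ[𝓝 z₁] fun s => (ŝ j s)⁻¹ * Λ j (v s).1 := by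
      filter_upwards [hW1] with s hs
      rw [if_pos hs.1.1.2, hEq j s hs.1.2 hs.1.1.1 hs.1.1.2 hs.2]
    have hf' : (fun z => if z ∈ O then Es z else (ŝ j z)⁻¹ * Λ j (v z).1) =ᶠ[𝓝 z₁] fun s => (ŝ j s)⁻¹ * Λ j (v s).1 := by
      filter_upwards [hW1] with s hs
      rw [if_pos hs.1.1.2, hEq j s hs.1.2 hs.1.1.1 hs.1.1.2 hs.2]
    have hNF := toMeromorphicNFOn_eqOn_of_eventuallyEq (subset_refl D) hDc (hSmer j' z₁' hz₁' hj'z₁') (hSmer j z (hUD hz) hjz) hz₁V.1.1 hgerm₁ hf hf'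
    -- near `z`: `S j' = NF(S j') = NF(S j) = S j = g_j`
    have h1 : (fun z => if z ∈ O then Es z else (ŝ j' z)⁻¹ * Λ j' (v z).1) =ᶠ[𝓝[≠] z]
        toMeromorphicNFOn (fun z => if z ∈ O then Es z else (ŝ j' z)⁻¹ * Λ j' (v z).1) D :=
      ((hSmer j' z₁' hz₁' hj'z₁').toMeromorphicNFOn_eq_self_on_nhdsNE (hUD hz)).symm
    have h2 : toMeromorphicNFOn (fun z => if z ∈ O then Es z else (ŝ j' z)⁻¹ * Λ j' (v z).1) D =ᶠ[𝓝[≠] z]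
        toMeromorphicNFOn (fun z => if z ∈ O then Es z else (ŝ j z)⁻¹ * Λ j (v z).1) D :=
      (eventually_of_mem (hD.mem_nhds (hUD hz)) hNF).filter_mono nhdsWithin_le_nhds
    have h3 : toMeromorphicNFOn (fun z => if z ∈ O then Es z else (ŝ j z)⁻¹ * Λ j (v z).1) D =ᶠ[𝓝[≠] z]
        (fun z => if z ∈ O then Es z else (ŝ j z)⁻¹ * Λ j (v z).1) :=
      (hSmer j z (hUD hz) hjz).toMeromorphicNFOn_eq_self_on_nhdsNE (hUD hz)
    have h4 : (fun z => if z ∈ O then Es z else (ŝ j z)⁻¹ * Λ j (v z).1) =ᶠ[𝓝[≠] z] fun s => (ŝ j s)⁻¹ * Λ j (v s).1 := by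
      refine (eventually_of_mem ((hUo.inter ((isOpen_ne_fun (hĥc j) continuous_const).inter hD)).mem_nhds ⟨hz, hjz, hUD hz⟩) fun s hs => ?_).filter_mono
        nhdsWithin_le_nhds
      show (if s ∈ O then Es s else (ŝ j s)⁻¹ * Λ j (v s).1) = (ŝ j s)⁻¹ * Λ j (v s).1
      by_cases hsO : s ∈ O
      · rw [if_pos hsO, hEq j s hs.1 hs.2.2 hsO hs.2.1]
      · rw [if_neg hsO]
    exact ((h1.trans h2).trans h3).trans h4
  refine ⟨fun z => if z ∈ O then Es z else (ŝ j₀ z)⁻¹ * Λ j₀ (v z).1, hSmer j₀ 0 h0D hj₀, fun z _ hz1 => by simp only [if_pos (show z ∈ O from hz1)],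
    fun j z hz hjz => hloc j₀ 0 h0D hj₀ j z hz hjz, fun z hz => ?_⟩
  obtain ⟨j, hjz⟩ := hcov z (hUD hz)
  rw [meromorphicOrderAt_congr (hloc j₀ 0 h0D hj₀ j z hz hjz)]
  exact (hgerm j z hz hjz).meromorphicOrderAt_nonneg


end Summit.HodgeConjecture.HodgeConjecture.Cruxes.H413.K2E1ChiEisensteinMeromorphicExportsU2Eigen

end
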